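import Literature.AlgebraicGeometry.Modules.ProjectiveFamilyTwistPushforward
import Literature.AlgebraicGeometry.Modules.SerreTwistMonomialSections
import Literature.AlgebraicGeometry.Modules.SubbundleEquationsBaseChange
import Literature.AlgebraicGeometry.Modules.CechBaseChangeHom
import Literature.AlgebraicGeometry.Modules.IsoOfSectionsOnBasis
import HarnessLib

/-!
# Base change of the Serre twists `𝒪_Z(e)` along a morphism `k : Y → Z` over `𝐏ʳ_A`
# (Hartshorne II Prop. 5.12 (c); Stacks Project Tag 01MX)

Layer `Literature/AlgebraicGeometry/Modules`, namespace `Literature.AlgebraicGeometry.Modules.SerreTwist`; THEOREMS ONLY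
(the one auxiliary morphism `pullbackTwistHom` is a `def` used to state them; no instance, no notation, no named fact,
no `sorry`).  Cell `hodgecm-mathlib` (D-0151), F-5 (5d-I) carve-out (γ1) (B-plan1 (g17) 09:31:13Z; author B-p19 (g16),
second hand B-p16 (g16)); consumers: FILE γ (fibres of a flat family), (III-Gr) (U1) «monomials restrict to monomials»
(B-p03), (R-L) (L2) (B-p18), (ε) (B-p09).

SETTING.  `ιZ : Z ⟶ 𝐏ʳ_A = ProjCech.PP A r`, `k : Y ⟶ Z` ANY morphism, `Y` over `𝐏ʳ_A` through `k ≫ ιZ`; `𝒪_Z(e) :=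
SerreTwist.twistMod ιZ (unitModule Z) e` (★ `Modules/SerreTwistMod`: sections = chart families `(n_j)` with
`n_j = (x_{j'}/x_j)^e n_{j'}`).  Since `Y_j = k⁻¹ Z_j` and `x_i/x_j` on `Y_j` is `k♯(x_i/x_j)` (definitionally, §1), pulling back
chart families componentwise is a morphism `ψ : 𝒪_Z(e) ⟶ k_* 𝒪_Y(e)` (§2); its transpose `pullbackTwistHom : k^* 𝒪_Z(e) ⟶ 𝒪_Y(e)`
(§3) sends `η_k(s)|_U` to `(k♯ s_j)_j` and is an ISOMORPHISM (§4): on an affine `U ⊆ k⁻¹V ∩ Y_j`, `V ⊆ Z_j` affine, both sides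
are free of rank one on the chart generator (★ `chartEquiv`, ★ `isBaseChange_unitSectionLE`), and such `U` form a basis (★
`isIso_of_bijective_on_basis`).  §5: monomial sections (★ `Modules/SerreTwistMonomialSections`) pull back to monomial sections.

Count-neutral capital (`--supports stmt-HodgeConjecture-24835`); HC_CM is proved only modulo the 7 printed citations until rung 0
closes, and this file discharges none of them.

## References
* [Hartshorne1977] R. Hartshorne, *Algebraic Geometry* (1977), II Prop. 5.12 (b), (c) (p. 117) and II §5 p. 110 (`f^* ⊣ f_*`).
* [StacksProject] The Stacks Project, Tag 01MX (functoriality of `𝒪(n)` under morphisms of `Proj`), Tag 01I8.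
-/

noncomputable section

-- `TopCat.Presheaf`/`Scheme.Modules` are not reducible (as in Mathlib's `AlgebraicGeometry/Modules/Sheaf.lean`).
set_option backward.isDefEq.respectTransparency false

open CategoryTheory CategoryTheory.Limits AlgebraicGeometry TopologicalSpace Opposite TensorProduct

universe u

namespace Literature.AlgebraicGeometry.Modules

namespace SerreTwist

open Literature.AlgebraicGeometry.Morphisms Literature.AlgebraicGeometry.Morphisms.ProjCech

variable {A : Type u} [CommRing A] {r : ℕ} {Y Z : Scheme.{u}} (k : Y ⟶ Z) (ιZ : Z ⟶ PP A r)

/-! ### §1 Charts and chart functions of `Y` over `𝐏ʳ_A` through `k ≫ ιZ` -/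

/-- `Y_s = k⁻¹ Z_s` (definitionally). [cite: Hartshorne1977, II Prop. 5.12 (c)] -/
theorem Zop_comp (s : Finset (Fin (r + 1))) : Zop (k ≫ ιZ) s = k ⁻¹ᵁ Zop ιZ s := rfl

/-- The chart function `x_i/x_j` of `Y` is `k♯` of the chart function of `Z` (definitionally: `(k ≫ ιZ)♯ = k♯ ∘ ιZ♯`).
[cite: Hartshorne1977, II Prop. 5.12 (c)] -/
theorem chartFun_comp (i j : Fin (r + 1)) : chartFun (k ≫ ιZ) i j = k.app (Zop ιZ {j}) (chartFun ιZ i j) := rfl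

/-- `k♯` followed by a restriction, elementwise (Mathlib `Scheme.Hom.appLE_map`; the compatibility of `k♯` with restrictions in
the definition of a morphism of ringed spaces). [cite: Hartshorne1977, II §2 (p. 72)] -/
theorem map_appLE_apply {V : Z.Opens} {U W : Y.Opens} (hU : U ≤ k ⁻¹ᵁ V) (hW : W ≤ U) (x : Γ(Z, V)) :
    Y.presheaf.map (homOfLE hW).op (k.appLE V U hU x) = k.appLE V W (hW.trans hU) x := by
  rw [← CategoryTheory.ConcreteCategory.comp_apply, Scheme.Hom.appLE_map]

/-- A restriction followed by `k♯`, elementwise (Mathlib `Scheme.Hom.map_appLE`). [cite: Hartshorne1977, II §2 (p. 72)] -/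
theorem appLE_map_apply {V V' : Z.Opens} {U : Y.Opens} (hV : V' ≤ V) (hU : U ≤ k ⁻¹ᵁ V') (x : Γ(Z, V)) :
    k.appLE V' U hU (Z.presheaf.map (homOfLE hV).op x) = k.appLE V U (hU.trans (k.preimage_mono hV)) x := by
  rw [← CategoryTheory.ConcreteCategory.comp_apply, Scheme.Hom.map_appLE]

/-- `k♯` on the chart function, restricted: `k♯((x_i/x_j)|_V)|_U = (x_i/x_j)|_U` for `U ⊆ k⁻¹V ∩ Y_j`.
[cite: Hartshorne1977, II Prop. 5.12 (c)] -/
theorem appLE_map_chartFun {V : Z.Opens} {U : Y.Opens} (i j : Fin (r + 1)) (hV : V ≤ Zop ιZ {j})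
    (hU : U ≤ k ⁻¹ᵁ V) :
    k.appLE V U hU (Z.presheaf.map (homOfLE hV).op (chartFun ιZ i j)) =
      Y.presheaf.map (homOfLE (hU.trans (k.preimage_mono hV) : U ≤ Zop (k ≫ ιZ) {j})).op (chartFun (k ≫ ιZ) i j) := by
  rw [appLE_map_apply, chartFun_comp, Scheme.Hom.app_eq_appLE]
  exact (map_appLE_apply k _ _ (chartFun ιZ i j)).symm

/-! ### §2 Pulling back chart families componentwise: `ψ : 𝒪_Z(e) ⟶ k_* 𝒪_Y(e)` -/

variable (e : ℕ)

/-- The componentwise pull-back `(k♯ s_j |_{U ∩ Y_j})_j` of the chart family of a section `s ∈ Γ(V, 𝒪_Z(e))`, for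
`U ⊆ k⁻¹V`. [cite: Hartshorne1977, II Prop. 5.12 (c)] -/
def pullFamily {V : Z.Opens} {U : Y.Opens} (hU : U ≤ k ⁻¹ᵁ V) (s : Γ(twistMod ιZ (unitModule Z) e, V)) :
    ChartFamily (k ≫ ιZ) (unitModule Y) U := fun j =>
  (show Γ(unitModule Y, U ⊓ Zop (k ≫ ιZ) {j}) from
    k.appLE (V ⊓ Zop ιZ {j}) (U ⊓ Zop (k ≫ ιZ) {j}) (inf_le_inf hU le_rfl)
      (show Γ(Z, V ⊓ Zop ιZ {j}) from comp ιZ (unitModule Z) s j))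

/-- Components of `pullFamily`. [cite: Hartshorne1977, II Prop. 5.12 (c)] -/
theorem pullFamily_apply {V : Z.Opens} {U : Y.Opens} (hU : U ≤ k ⁻¹ᵁ V) (s : Γ(twistMod ιZ (unitModule Z) e, V))
    (j : Fin (r + 1)) :
    (show Γ(Y, U ⊓ Zop (k ≫ ιZ) {j}) from pullFamily k ιZ e hU s j) =
      k.appLE (V ⊓ Zop ιZ {j}) (U ⊓ Zop (k ≫ ιZ) {j}) (inf_le_inf hU le_rfl)
        (show Γ(Z, V ⊓ Zop ιZ {j}) from comp ιZ (unitModule Z) s j) := rfl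

/-- **The pulled-back family satisfies the transition rule of `𝒪_Y(e)`** (`k♯` is a ring map and `k♯(x_{j'}/x_j) =
x_{j'}/x_j`). [cite: Hartshorne1977, II Prop. 5.12 (c)] -/
theorem isTwistFamily_pullFamily {V : Z.Opens} {U : Y.Opens} (hU : U ≤ k ⁻¹ᵁ V)
    (s : Γ(twistMod ιZ (unitModule Z) e, V)) :
    IsTwistFamily (k ≫ ιZ) (unitModule Y) e U (pullFamily k ιZ e hU s) := by
  intro j j' W hW hj hj'
  -- the transition rule of `s` on `V ∩ Z_j ∩ Z_{j'}`, pushed through the ring map `k♯ : Γ(V ∩ Z_j ∩ Z_{j'}) → Γ(W)`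
  have key := isTwistFamily_comp ιZ (unitModule Z) s j j' (V := V ⊓ Zop ιZ {j} ⊓ Zop ιZ {j'})
    (inf_le_left.trans inf_le_left) (inf_le_left.trans inf_le_right) inf_le_right
  have hWV : W ≤ k ⁻¹ᵁ (V ⊓ Zop ιZ {j} ⊓ Zop ιZ {j'}) := le_inf (le_inf (hW.trans hU) hj) hj'
  have key' := congrArg (k.appLE _ W hWV) key
  change k.appLE _ W hWV (Z.presheaf.map _ (show Γ(Z, V ⊓ Zop ιZ {j}) from comp ιZ (unitModule Z) s j)) =
    k.appLE _ W hWV (Z.presheaf.map _ (chartFun ιZ j' j) ^ e *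
      Z.presheaf.map _ (show Γ(Z, V ⊓ Zop ιZ {j'}) from comp ιZ (unitModule Z) s j')) at key'
  rw [map_mul, map_pow, appLE_map_apply, appLE_map_apply, appLE_map_apply] at key'
  have h1 : Y.presheaf.map (homOfLE (le_inf hW hj)).op
      (k.appLE (V ⊓ Zop ιZ {j}) (U ⊓ Zop (k ≫ ιZ) {j}) (inf_le_inf hU le_rfl)
        (show Γ(Z, V ⊓ Zop ιZ {j}) from comp ιZ (unitModule Z) s j)) =
      k.appLE (V ⊓ Zop ιZ {j}) W ((le_inf hW hj).trans (inf_le_inf hU le_rfl))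
        (show Γ(Z, V ⊓ Zop ιZ {j}) from comp ιZ (unitModule Z) s j) := map_appLE_apply k _ _ _
  have h2 : Y.presheaf.map (homOfLE (le_inf hW hj')).op
      (k.appLE (V ⊓ Zop ιZ {j'}) (U ⊓ Zop (k ≫ ιZ) {j'}) (inf_le_inf hU le_rfl)
        (show Γ(Z, V ⊓ Zop ιZ {j'}) from comp ιZ (unitModule Z) s j')) =
      k.appLE (V ⊓ Zop ιZ {j'}) W ((le_inf hW hj').trans (inf_le_inf hU le_rfl))
        (show Γ(Z, V ⊓ Zop ιZ {j'}) from comp ιZ (unitModule Z) s j') := map_appLE_apply k _ _ _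
  have h3 : Y.presheaf.map (homOfLE hj).op (chartFun (k ≫ ιZ) j' j) =
      k.appLE (Zop ιZ {j}) W hj (chartFun ιZ j' j) := by
    rw [chartFun_comp, Scheme.Hom.app_eq_appLE]
    exact map_appLE_apply k _ _ _
  change Y.presheaf.map (homOfLE (le_inf hW hj)).op
      (k.appLE (V ⊓ Zop ιZ {j}) (U ⊓ Zop (k ≫ ιZ) {j}) (inf_le_inf hU le_rfl)
        (show Γ(Z, V ⊓ Zop ιZ {j}) from comp ιZ (unitModule Z) s j)) =
    Y.presheaf.map (homOfLE hj).op (chartFun (k ≫ ιZ) j' j) ^ e *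
      Y.presheaf.map (homOfLE (le_inf hW hj')).op
        (k.appLE (V ⊓ Zop ιZ {j'}) (U ⊓ Zop (k ≫ ιZ) {j'}) (inf_le_inf hU le_rfl)
          (show Γ(Z, V ⊓ Zop ιZ {j'}) from comp ιZ (unitModule Z) s j'))
  rw [h1, h2, h3]
  exact key'

/-- The pulled-back family glued: the section `(k♯ s_j)_j ∈ Γ(U, 𝒪_Y(e))`. [cite: Hartshorne1977, II Prop. 5.12 (c)] -/
def pullSection {V : Z.Opens} {U : Y.Opens} (hU : U ≤ k ⁻¹ᵁ V) (s : Γ(twistMod ιZ (unitModule Z) e, V)) :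
    Γ(twistMod (k ≫ ιZ) (unitModule Y) e, U) :=
  mkFamily (k ≫ ιZ) (unitModule Y) (pullFamily k ιZ e hU s) (isTwistFamily_pullFamily k ιZ e hU s)

/-- Chart pieces of `pullSection`: `k♯ s_j`. [cite: Hartshorne1977, II Prop. 5.12 (c)] -/
@[simp]
theorem comp_pullSection {V : Z.Opens} {U : Y.Opens} (hU : U ≤ k ⁻¹ᵁ V) (s : Γ(twistMod ιZ (unitModule Z) e, V))
    (j : Fin (r + 1)) :
    (show Γ(Y, U ⊓ Zop (k ≫ ιZ) {j}) from comp (k ≫ ιZ) (unitModule Y) (pullSection k ιZ e hU s) j) =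
      k.appLE (V ⊓ Zop ιZ {j}) (U ⊓ Zop (k ≫ ιZ) {j}) (inf_le_inf hU le_rfl)
        (show Γ(Z, V ⊓ Zop ιZ {j}) from comp ιZ (unitModule Z) s j) := rfl

/-- `pullSection` is additive. [folklore] -/
private theorem pullSection_add {V : Z.Opens} {U : Y.Opens} (hU : U ≤ k ⁻¹ᵁ V) (s s' : Γ(twistMod ιZ (unitModule Z) e, V)) :
    pullSection k ιZ e hU (s + s') = pullSection k ιZ e hU s + pullSection k ιZ e hU s' := by
  apply twistMod_ext
  intro j
  rw [comp_add]
  change k.appLE _ _ _ (show Γ(Z, V ⊓ Zop ιZ {j}) from comp ιZ (unitModule Z) (s + s') j) =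
    k.appLE _ _ _ (show Γ(Z, V ⊓ Zop ιZ {j}) from comp ιZ (unitModule Z) s j) +
      k.appLE _ _ _ (show Γ(Z, V ⊓ Zop ιZ {j}) from comp ιZ (unitModule Z) s' j)
  rw [comp_add, map_add]

/-- `pullSection` is compatible with restriction: `(k♯ s_j)|_W = k♯ (s|_{V'})_j` for `W ⊆ U`, `W ⊆ k⁻¹V'`, `V' ⊆ V`.
[folklore] -/
private theorem pullSection_map {V V' : Z.Opens} {U W : Y.Opens} (hU : U ≤ k ⁻¹ᵁ V) (hW : W ≤ k ⁻¹ᵁ V') (hV : V' ≤ V)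
    (hWU : W ≤ U) (s : Γ(twistMod ιZ (unitModule Z) e, V)) :
    pullSection k ιZ e hW ((twistMod ιZ (unitModule Z) e).presheaf.map (homOfLE hV).op s) =
      (twistMod (k ≫ ιZ) (unitModule Y) e).presheaf.map (homOfLE hWU).op (pullSection k ιZ e hU s) := by
  apply twistMod_ext
  intro j
  rw [comp_map]
  change k.appLE _ _ _ (show Γ(Z, V' ⊓ Zop ιZ {j}) from
      comp ιZ (unitModule Z) ((twistMod ιZ (unitModule Z) e).presheaf.map (homOfLE hV).op s) j) =
    Y.presheaf.map _ (k.appLE _ _ _ (show Γ(Z, V ⊓ Zop ιZ {j}) from comp ιZ (unitModule Z) s j))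
  rw [comp_map, map_appLE_apply]
  exact appLE_map_apply k _ _ _

/-- `pullSection` is `k♯`-semilinear: `k♯(a · s) = k♯(a) · k♯(s)`. [folklore] -/
private theorem pullSection_smul {V : Z.Opens} (a : Γ(Z, V)) (s : Γ(twistMod ιZ (unitModule Z) e, V)) :
    pullSection k ιZ e (le_refl (k ⁻¹ᵁ V)) (a • s) = k.app V a • pullSection k ιZ e (le_refl (k ⁻¹ᵁ V)) s := by
  apply twistMod_ext
  intro j
  rw [comp_smul]
  change k.appLE _ _ _ (show Γ(Z, V ⊓ Zop ιZ {j}) from comp ιZ (unitModule Z) (a • s) j) =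
    Y.presheaf.map _ (k.app V a) * k.appLE _ _ _ (show Γ(Z, V ⊓ Zop ιZ {j}) from comp ιZ (unitModule Z) s j)
  rw [comp_smul]
  change k.appLE _ _ _ (Z.presheaf.map _ a * (show Γ(Z, V ⊓ Zop ιZ {j}) from comp ιZ (unitModule Z) s j)) = _
  rw [map_mul, appLE_map_apply, Scheme.Hom.app_eq_appLE, map_appLE_apply]

/-- **`ψ : 𝒪_Z(e) ⟶ k_* 𝒪_Y(e)`, `s ↦ (k♯ s_j)_j`** (the `PresheafOfModules.homMk` pattern). [cite: Hartshorne1977, II Prop. 5.12 (c)] -/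
def pushforwardTwistHom :
    twistMod ιZ (unitModule Z) e ⟶ (Scheme.Modules.pushforward k).obj (twistMod (k ≫ ιZ) (unitModule Y) e) where
  val := PresheafOfModules.homMk
    { app := fun V => AddCommGrpCat.ofHom
        { toFun := fun s => (pullSection k ιZ e (le_refl (k ⁻¹ᵁ V.unop)) s :
            Γ(twistMod (k ≫ ιZ) (unitModule Y) e, k ⁻¹ᵁ V.unop))
          map_zero' := by
            have h := pullSection_add k ιZ e (le_refl (k ⁻¹ᵁ V.unop)) 0 0
            rw [add_zero] at h
            exact left_eq_add.mp h
          map_add' := pullSection_add k ιZ e (le_refl (k ⁻¹ᵁ V.unop)) }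
      naturality := fun {V V'} g => by
        ext s
        exact pullSection_map k ιZ e (le_refl _) (le_refl _) g.unop.le (k.preimage_mono g.unop.le) s }
    (fun V a s => by
      change pullSection k ιZ e (le_refl _) (a • s) = k.app V.unop a • pullSection k ιZ e (le_refl _) s
      exact pullSection_smul k ιZ e a s)

/-- Sections of `ψ`. [cite: Hartshorne1977, II Prop. 5.12 (c)] -/
theorem pushforwardTwistHom_app (V : Z.Opens) (s : Γ(twistMod ιZ (unitModule Z) e, V)) :
    (pushforwardTwistHom k ιZ e).app V s = pullSection k ιZ e (le_refl (k ⁻¹ᵁ V)) s := rfl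

/-! ### §3 The transpose `k^* 𝒪_Z(e) ⟶ 𝒪_Y(e)` and its values on pulled-back sections -/

/-- **The base-change morphism `k^* 𝒪_Z(e) ⟶ 𝒪_Y(e)`**: the transpose of `ψ` across `k^* ⊣ k_*`.
[cite: Hartshorne1977, II Prop. 5.12 (c)] [cite: StacksProject, Tag 01MX] -/
def pullbackTwistHom :
    (Scheme.Modules.pullback k).obj (twistMod ιZ (unitModule Z) e) ⟶ twistMod (k ≫ ιZ) (unitModule Y) e :=
  ((Scheme.Modules.pullbackPushforwardAdjunction k).homEquiv _ _).symm (pushforwardTwistHom k ιZ e)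

/-- **Values on pulled-back sections**: the base-change morphism sends `η_k(s)|_U` (`s ∈ Γ(V, 𝒪_Z(e))`, `U ⊆ k⁻¹V`) to the
glued family `(k♯ s_j)_j` (★ `transpose_app_unitSection`). [cite: Hartshorne1977, II Prop. 5.12 (c) and II §5 p. 110] -/
theorem pullbackTwistHom_app_unitSectionLE {V : Z.Opens} {U : Y.Opens} (hU : U ≤ k ⁻¹ᵁ V)
    (s : Γ(twistMod ιZ (unitModule Z) e, V)) :
    (pullbackTwistHom k ιZ e).app U (unitSectionLE k (twistMod ιZ (unitModule Z) e) hU s) =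
      pullSection k ιZ e hU s := by
  rw [unitSectionLE, ← hom_map_app, pullbackTwistHom, transpose_app_unitSection]
  change (twistMod (k ≫ ιZ) (unitModule Y) e).presheaf.map (homOfLE hU).op (pullSection k ιZ e (le_refl _) s) = _
  rw [← pullSection_map k ιZ e (le_refl _) hU (le_refl V) hU s]
  congr 1
  exact map_id_apply _ s

/-- **Chart formula**: the `j`-th piece of the image of `η_k(s)|_U` is `k♯(s_j)|_{U ∩ Y_j}`.
[cite: Hartshorne1977, II Prop. 5.12 (c)] -/
theorem comp_pullbackTwistHom_app_unitSectionLE {V : Z.Opens} {U : Y.Opens} (hU : U ≤ k ⁻¹ᵁ V)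
    (s : Γ(twistMod ιZ (unitModule Z) e, V)) (j : Fin (r + 1)) :
    (show Γ(Y, U ⊓ Zop (k ≫ ιZ) {j}) from
      comp (k ≫ ιZ) (unitModule Y)
        ((pullbackTwistHom k ιZ e).app U (unitSectionLE k (twistMod ιZ (unitModule Z) e) hU s)) j) =
      k.appLE (V ⊓ Zop ιZ {j}) (U ⊓ Zop (k ≫ ιZ) {j}) (inf_le_inf hU le_rfl)
        (show Γ(Z, V ⊓ Zop ιZ {j}) from comp ιZ (unitModule Z) s j) := by
  rw [pullbackTwistHom_app_unitSectionLE]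
  rfl

/-! ### §4 The base-change morphism is an isomorphism -/

/-- The affine opens `U ⊆ k⁻¹V ∩ Y_j` with `V ⊆ Z_j` affine form a basis of `Y` (the `Z_j` cover `Z`, affine opens are bases).
[folklore] -/
private theorem isBasis_affineOpens_le_preimage_chart :
    Opens.IsBasis {U : Y.Opens | IsAffineOpen U ∧ ∃ (j : Fin (r + 1)) (V : Z.Opens),
      IsAffineOpen V ∧ V ≤ Zop ιZ {j} ∧ U ≤ k ⁻¹ᵁ V} := by
  rw [Opens.isBasis_iff_nbhd]
  intro U₀ y hy
  have hcov : k.base y ∈ ⨆ j : Fin (r + 1), (⊤ : Z.Opens) ⊓ Zop ιZ {j} :=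
    le_iSup_inf_Zop ιZ ⊤ (show k.base y ∈ (⊤ : Z.Opens) from trivial)
  obtain ⟨j, hj⟩ := Opens.mem_iSup.mp hcov
  obtain ⟨V, hVaff, hyV, hVle⟩ := (Opens.isBasis_iff_nbhd.mp Z.isBasis_affineOpens) (show k.base y ∈ Zop ιZ {j} from hj.2)
  obtain ⟨U, hUaff, hyU, hUle⟩ :=
    (Opens.isBasis_iff_nbhd.mp Y.isBasis_affineOpens) (show y ∈ U₀ ⊓ k ⁻¹ᵁ V from ⟨hy, hyV⟩)
  exact ⟨U, ⟨hUaff, j, V, hVaff, hVle, hUle.trans inf_le_right⟩, hyU, hUle.trans inf_le_left⟩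

/-- **On a chart the base-change morphism is bijective on sections.**  For `U ⊆ k⁻¹V ∩ Y_j` affine with `V ⊆ Z_j` affine,
`Γ(U, k^* 𝒪_Z(e)) = Γ(U) ⊗_{Γ(V)} Γ(V, 𝒪_Z(e))` (★ `isBaseChange_unitSectionLE`) is free of rank one on `η_k(g)` for the
chart generator `g` (`g_j = 1`), and `Γ(U, 𝒪_Y(e)) ≃ Γ(U, 𝒪_Y)` (★ `chartEquiv`) takes the image of `c · η_k(g)` to `c`.
[cite: Hartshorne1977, II Prop. 5.12 (b), (c)] [cite: StacksProject, Tag 01I8] -/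
theorem pullbackTwistHom_app_bijective {U : Y.Opens} (hU : IsAffineOpen U) {j : Fin (r + 1)} {V : Z.Opens}
    (hV : IsAffineOpen V) (hVj : V ≤ Zop ιZ {j}) (hUV : U ≤ k ⁻¹ᵁ V) :
    Function.Bijective ((pullbackTwistHom k ιZ e).app U) := by
  have hUj : U ≤ Zop (k ≫ ιZ) {j} := hUV.trans (k.preimage_mono hVj)
  letI := (k.appLE V U hUV).hom.toAlgebra
  letI : Module Γ(Z, V) Γ((Scheme.Modules.pullback k).obj (twistMod ιZ (unitModule Z) e), U) :=
    Module.compHom _ (k.appLE V U hUV).hom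
  haveI : IsScalarTower Γ(Z, V) Γ(Y, U) Γ((Scheme.Modules.pullback k).obj (twistMod ιZ (unitModule Z) e), U) :=
    ⟨fun a c x => mul_smul ((k.appLE V U hUV).hom a) c x⟩
  have hη := isBaseChange_unitSectionLE (f := k) (M := twistMod ιZ (unitModule Z) e) (i := hUV) hV hU
    (isAffineLocalizing_twistMod_unitModule ιZ e)
  -- the chart generator `g ∈ Γ(V, 𝒪_Z(e))`, `g_j|_V = 1`
  obtain ⟨g, hg⟩ : ∃ g : Γ(twistMod ιZ (unitModule Z) e, V),
      chartEquiv ιZ (unitModule Z) e hVj g = (show Γ(unitModule Z, V) from (1 : Γ(Z, V))) :=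
    ⟨(chartEquiv ιZ (unitModule Z) e hVj).symm _, LinearEquiv.apply_symm_apply _ _⟩
  -- `L := chartEquiv ∘ φ_U`, a `Γ(U)`-linear map `Γ(U, k^* 𝒪_Z(e)) → Γ(U, 𝒪_Y)`
  let φl : Γ((Scheme.Modules.pullback k).obj (twistMod ιZ (unitModule Z) e), U) →ₗ[Γ(Y, U)]
      Γ(twistMod (k ≫ ιZ) (unitModule Y) e, U) :=
    { toFun := (pullbackTwistHom k ιZ e).app U
      map_add' := fun x y => map_add _ x y
      map_smul' := fun c x => Scheme.Modules.Hom.app_smul _ c x }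
  let L := (chartEquiv (k ≫ ιZ) (unitModule Y) e hUj).toLinearMap ∘ₗ φl
  -- `L(η(s)) = k♯(s_j|_V)`, in particular `L(η(g)) = 1`
  have hL : ∀ s : Γ(twistMod ιZ (unitModule Z) e, V),
      (show Γ(Y, U) from L (unitSectionLE k (twistMod ιZ (unitModule Z) e) hUV s)) =
        k.appLE V U hUV (show Γ(Z, V) from chartEquiv ιZ (unitModule Z) e hVj s) := by
    intro s
    change (show Γ(Y, U) from chartEquiv (k ≫ ιZ) (unitModule Y) e hUj
      ((pullbackTwistHom k ιZ e).app U (unitSectionLE k (twistMod ιZ (unitModule Z) e) hUV s))) = _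
    rw [chartEquiv_apply, chartEquiv_apply, pullbackTwistHom_app_unitSectionLE]
    change Y.presheaf.map _ (show Γ(Y, U ⊓ Zop (k ≫ ιZ) {j}) from
        comp (k ≫ ιZ) (unitModule Y) (pullSection k ιZ e hUV s) j) =
      k.appLE V U hUV (Z.presheaf.map _ (show Γ(Z, V ⊓ Zop ιZ {j}) from comp ιZ (unitModule Z) s j))
    rw [comp_pullSection, map_appLE_apply, appLE_map_apply]
  have hLg : L (unitSectionLE k (twistMod ιZ (unitModule Z) e) hUV g) =
      (show Γ(unitModule Y, U) from (1 : Γ(Y, U))) := by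
    have h := hL g
    rw [hg] at h
    change (show Γ(Y, U) from L (unitSectionLE k (twistMod ιZ (unitModule Z) e) hUV g)) = k.appLE V U hUV 1 at h
    rw [map_one] at h
    exact h
  -- every element of `Γ(U, k^* 𝒪_Z(e))` is `c • η(g)`
  have hgen : ∀ x : Γ((Scheme.Modules.pullback k).obj (twistMod ιZ (unitModule Z) e), U),
      ∃ c : Γ(Y, U), x = c • unitSectionLE k (twistMod ιZ (unitModule Z) e) hUV g := by
    intro x
    obtain ⟨t, rfl⟩ := hη.equiv.surjective x
    induction t using TensorProduct.induction_on with
    | zero => exact ⟨0, by rw [map_zero, zero_smul]⟩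
    | tmul c s =>
      refine ⟨c * k.appLE V U hUV (show Γ(Z, V) from chartEquiv ιZ (unitModule Z) e hVj s), ?_⟩
      have hs : s = (show Γ(Z, V) from chartEquiv ιZ (unitModule Z) e hVj s) • g := by
        apply (chartEquiv ιZ (unitModule Z) e hVj).injective
        rw [map_smul, hg]
        change _ = (show Γ(Z, V) from chartEquiv ιZ (unitModule Z) e hVj s) * 1
        rw [mul_one]
      change hη.equiv (c ⊗ₜ s) = _
      rw [IsBaseChange.equiv_tmul, mul_smul]
      congr 1
      conv_lhs => rw [hs]
      exact unitSectionLE_smul k (twistMod ιZ (unitModule Z) e) hUV _ g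
    | add t₁ t₂ h₁ h₂ =>
      obtain ⟨c₁, hc₁⟩ := h₁
      obtain ⟨c₂, hc₂⟩ := h₂
      exact ⟨c₁ + c₂, by rw [map_add, hc₁, hc₂, add_smul]⟩
  have hLc : ∀ c : Γ(Y, U), L (c • unitSectionLE k (twistMod ιZ (unitModule Z) e) hUV g) =
      (show Γ(unitModule Y, U) from c) := by
    intro c
    rw [map_smul, hLg]
    change c * 1 = c
    exact mul_one c
  constructor
  · intro x x' hxx'
    obtain ⟨c, rfl⟩ := hgen x
    obtain ⟨c', rfl⟩ := hgen x'
    have h : L (c • unitSectionLE k (twistMod ιZ (unitModule Z) e) hUV g) =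
        L (c' • unitSectionLE k (twistMod ιZ (unitModule Z) e) hUV g) := by
      change chartEquiv (k ≫ ιZ) (unitModule Y) e hUj ((pullbackTwistHom k ιZ e).app U _) =
        chartEquiv (k ≫ ιZ) (unitModule Y) e hUj ((pullbackTwistHom k ιZ e).app U _)
      rw [hxx']
    rw [hLc, hLc] at h
    change c = c' at h
    rw [h]
  · intro y
    refine ⟨(show Γ(Y, U) from chartEquiv (k ≫ ιZ) (unitModule Y) e hUj y) •
      unitSectionLE k (twistMod ιZ (unitModule Z) e) hUV g, ?_⟩
    apply (chartEquiv (k ≫ ιZ) (unitModule Y) e hUj).injective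
    exact hLc _

/-- **`k^* 𝒪_Z(e) ≅ 𝒪_Y(e)`: the base-change morphism is an isomorphism** (bijective on a basis of opens, ★
`isIso_of_bijective_on_basis`). [cite: Hartshorne1977, II Prop. 5.12 (c)] [cite: StacksProject, Tag 01MX] -/
theorem isIso_pullbackTwistHom : IsIso (pullbackTwistHom k ιZ e) :=
  isIso_of_bijective_on_basis _ (isBasis_affineOpens_le_preimage_chart k ιZ) fun _ hU => by
    obtain ⟨hUaff, j, V, hVaff, hVj, hUV⟩ := hU
    exact pullbackTwistHom_app_bijective k ιZ e hUaff hVaff hVj hUV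

/-- **`∃`-form for consumers**: an isomorphism `k^* 𝒪_Z(e) ≅ 𝒪_Y(e)` whose values on the pulled-back sections `η_k(s)|_U`
have chart pieces `k♯(s_j)`. [cite: Hartshorne1977, II Prop. 5.12 (c)] [cite: StacksProject, Tag 01MX] -/
theorem exists_pullback_twistMod_unitModule_iso :
    ∃ φ : (Scheme.Modules.pullback k).obj (twistMod ιZ (unitModule Z) e) ≅ twistMod (k ≫ ιZ) (unitModule Y) e,
      ∀ ⦃V : Z.Opens⦄ ⦃U : Y.Opens⦄ (hU : U ≤ k ⁻¹ᵁ V) (s : Γ(twistMod ιZ (unitModule Z) e, V)) (j : Fin (r + 1)),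
        (show Γ(Y, U ⊓ Zop (k ≫ ιZ) {j}) from
          comp (k ≫ ιZ) (unitModule Y) (φ.hom.app U (unitSectionLE k (twistMod ιZ (unitModule Z) e) hU s)) j) =
        k.appLE (V ⊓ Zop ιZ {j}) (U ⊓ Zop (k ≫ ιZ) {j}) (inf_le_inf hU le_rfl)
          (show Γ(Z, V ⊓ Zop ιZ {j}) from comp ιZ (unitModule Z) s j) :=
  haveI := isIso_pullbackTwistHom k ιZ e
  ⟨asIso (pullbackTwistHom k ιZ e), fun _ _ hU s j => comp_pullbackTwistHom_app_unitSectionLE k ιZ e hU s j⟩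

/-! ### §5 Monomial sections pull back to monomial sections -/

/-- **`η_k(μ_w|_Z) ↦ μ_w|_Y`**: the base-change isomorphism takes the pulled-back monomial section of degree `e` and word `w`
(★ `SerreTwist.monomialSection`) to the monomial section of `Y` («monomials restrict to monomials»).
[cite: Hartshorne1977, II Prop. 5.12 (c)] -/
theorem pullbackTwistHom_app_unitSectionLE_monomialSection (w : Fin e → Fin (r + 1)) :
    (pullbackTwistHom k ιZ e).app ⊤
        (unitSectionLE k (twistMod ιZ (unitModule Z) e) (V := ⊤) (U := ⊤) le_top (monomialSection ιZ e w)) =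
      monomialSection (k ≫ ιZ) e w := by
  rw [pullbackTwistHom_app_unitSectionLE]
  apply twistMod_ext
  intro j
  change k.appLE _ _ _ (show Γ(Z, ⊤ ⊓ Zop ιZ {j}) from comp ιZ (unitModule Z) (monomialSection ιZ e w) j) =
    (show Γ(Y, ⊤ ⊓ Zop (k ≫ ιZ) {j}) from comp (k ≫ ιZ) (unitModule Y) (monomialSection (k ≫ ιZ) e w) j)
  rw [comp_monomialSection_eq_map_wordFun, comp_monomialSection_eq_map_wordFun, appLE_map_apply, wordFun, wordFun,
    map_prod, map_prod]
  refine Finset.prod_congr rfl fun t _ => ?_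
  rw [chartFun_comp, Scheme.Hom.app_eq_appLE]
  exact (map_appLE_apply k _ _ _).symm

/-- The same on an open `U ⊆ Y`: `η_k(μ_w|_Z)|_U = (μ_w|_Y)|_U`. [cite: Hartshorne1977, II Prop. 5.12 (c)] -/
theorem pullbackTwistHom_app_unitSectionLE_monomialSection_le (w : Fin e → Fin (r + 1)) (U : Y.Opens) :
    (pullbackTwistHom k ιZ e).app U
        (unitSectionLE k (twistMod ιZ (unitModule Z) e) (V := ⊤) (le_top : U ≤ k ⁻¹ᵁ ⊤) (monomialSection ιZ e w)) =
      (twistMod (k ≫ ιZ) (unitModule Y) e).presheaf.map (homOfLE (le_top : U ≤ ⊤)).op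
        (monomialSection (k ≫ ιZ) e w) := by
  have h : unitSectionLE k (twistMod ιZ (unitModule Z) e) (V := ⊤) (le_top : U ≤ k ⁻¹ᵁ ⊤) (monomialSection ιZ e w) =
      ((Scheme.Modules.pullback k).obj (twistMod ιZ (unitModule Z) e)).presheaf.map (homOfLE (le_top : U ≤ ⊤)).op
        (unitSectionLE k (twistMod ιZ (unitModule Z) e) (V := ⊤) (U := ⊤) le_top (monomialSection ιZ e w)) := by
    simp only [unitSectionLE]
    rw [← CategoryTheory.comp_apply, ← Functor.map_comp]
    rfl
  rw [h, ← hom_map_app, pullbackTwistHom_app_unitSectionLE_monomialSection]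

end SerreTwist

end Literature.AlgebraicGeometry.Modules

end
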